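import Mathlib
import Summits.Ventures.PercRepro.TriangleCapFiveRowThreeCap

/-!
# PercRepro — THE CAP ON THE CELL `(k, 5, 3)`, ASSEMBLED: a `K₄⁻`-free graph with `5 (k − 5) − 3` edges on `k ≥ 13`
vertices with a vertex of degree `k − 5` is `5`-bipartite or at least `T = 2k − 22` below the closed form (p3,
gen 46; part 199g, second half)

The pieces of the first half (`five_three_cap_count`, `five_three_cap_count_eight`, `five_three_noedge`,
`five_three_noedge_eight`, `cap_sq_bound_five`, `five_three_cap_sq_arith`) are assembled on the count of part 198a
(`four_cap`) with four non-neighbours: `E = 0` and `M ≤ 1` (for `K ≥ 9` by the count, for `K = 8` by the structure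
lemma), `M = 0` is `D ⊆ K(N(x)ᶜ, N(x))`, `M = 1` is the family `T` with `Σ_R d² ≤ (K − 1) P = 4 (K − 1)²` and
`Σ_N d² ≤ K + 14 + 6P`, exactly the target. Axioms: standard.
-/

namespace PercRepro

namespace TriangleCap

namespace C047

open Finset

variable {V : Type*} [Fintype V] [DecidableEq V]

/-- **THE CAP ON THE CELL `(k, 5, 3)`, `k ≥ 13`:** a `K₄⁻`-free graph with `5 (k − 5) − 3` edges and a vertex `x` of
degree `k − 5` is a spanning subgraph of some `K(A, Aᶜ)` with `|A| = 5`, or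
`Σ_v d(v)² + 3 (k − 4) + (2k − 22) ≤ m k` (the one-triangle family `T`, exact). -/
theorem five_three_cap (D : SimpleGraph V) [DecidableRel D.Adj] (hK : K4mFree D) (hk : 13 ≤ Fintype.card V)
    (hm : D.edgeFinset.card + 3 = 5 * (Fintype.card V - 5)) (x : V) (hx : deg D x + 5 = Fintype.card V) :
    (∃ A : Finset V, A.card = 5 ∧ BipSub D A) ∨
      ∑ v, deg D v * deg D v + 3 * (Fintype.card V - 4) + (2 * Fintype.card V - 22) ≤
        D.edgeFinset.card * Fintype.card V := by
  obtain ⟨N, hN⟩ : ∃ N : Finset V, N = univ.filter (fun w => D.Adj x w) := ⟨_, rfl⟩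
  have hmemN : ∀ w, w ∈ N ↔ D.Adj x w := fun w => by rw [hN, mem_filter]; simp only [mem_univ, true_and]
  have hxN : x ∉ N := fun h => D.irrefl ((hmemN x).mp h)
  have hdx : deg D x = N.card := by rw [hN]; rfl
  obtain ⟨K, hKdef⟩ : ∃ K, N.card = K := ⟨_, rfl⟩
  have hcardV : Fintype.card V = K + 5 := by omega
  obtain ⟨m, hmdef⟩ : ∃ m, D.edgeFinset.card = m := ⟨_, rfl⟩
  rw [hmdef, hcardV, Nat.add_sub_cancel] at hm
  -- the non-neighbours `R`, `|R| = 4`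
  obtain ⟨R, hR⟩ : ∃ R : Finset V, R = (insert x N)ᶜ := ⟨_, rfl⟩
  have hRcard : R.card = 4 := by
    rw [hR, card_compl, card_insert_of_notMem hxN]
    omega
  have hmemR : ∀ w, w ∈ R ↔ w ≠ x ∧ ¬ D.Adj x w := by
    intro w
    rw [hR, mem_compl, mem_insert, hmemN]
    tauto
  -- the matching inside `N`
  obtain ⟨M, hM⟩ : ∃ M, adjPairs D N = 2 * M := ⟨_, adjPairs_eq_two_mul D N⟩
  have hTf : ∑ y ∈ N, degIn D N y = 2 * M := by rw [← adjPairs_eq_sum_degIn, hM]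
  -- `P = Σ_{u ∈ R} degIn N u`, `E = adjPairs R`
  obtain ⟨P, hPdef⟩ : ∃ P, ∑ u ∈ R, degIn D N u = P := ⟨_, rfl⟩
  obtain ⟨E, hEdef⟩ : ∃ E, adjPairs D R = E := ⟨_, rfl⟩
  -- the degree sum over `{x} ∪ N ∪ R`
  have hsplit : ∀ F : V → ℕ, ∑ w, F w = F x + ∑ y ∈ N, F y + ∑ u ∈ R, F u := by
    intro F
    rw [← sum_add_sum_compl (insert x N), sum_insert hxN, ← hR]
  have hdegN : ∀ y ∈ N, deg D y = 1 + degIn D N y + degIn D R y := by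
    intro y hy
    have := deg_eq_of_mem_nbhd D x y ((hmemN y).mp hy)
    rw [← hN, ← hR] at this
    exact this
  have hsumN : ∑ y ∈ N, deg D y = K + 2 * M + P := by
    rw [sum_congr rfl hdegN, sum_add_distrib, sum_add_distrib, sum_const, smul_eq_mul, mul_one, hKdef, hTf,
      sum_degIn_comm D N R, hPdef]
  have hdegR : ∀ u ∈ R, deg D u = degIn D N u + degIn D R u := by
    intro u hu
    have := deg_eq_of_not_mem_nbhd D x u ((hmemR u).mp hu).2
    rw [← hN, ← hR] at this
    exact this
  have hsumR : ∑ u ∈ R, deg D u = P + E := by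
    rw [sum_congr rfl hdegR, sum_add_distrib, hPdef, ← adjPairs_eq_sum_degIn, hEdef]
  have hdegsum := sum_deg_eq D
  rw [hsplit, hsumN, hsumR, hdx, hKdef, hmdef] at hdegsum
  -- (2) every vertex of `R` has at most `K − M` neighbours in `N`
  have hPle : ∀ u ∈ R, degIn D N u + M ≤ K := by
    intro u hu
    have := two_mul_degIn_add_adjPairs_le D hK (x := x) ((hmemR u).mp hu).1
    rw [← hN, hM, hKdef] at this
    omega
  have h2 : P + 4 * M ≤ 4 * K := by
    have hs : ∑ u ∈ R, (degIn D N u + M) ≤ ∑ _u ∈ R, K := sum_le_sum hPle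
    rw [sum_add_distrib, sum_const, sum_const, smul_eq_mul, smul_eq_mul, hPdef, hRcard] at hs
    exact hs
  -- (3) `E ≤ 8`: `K₄⁻`-freeness on `R`
  have hE8 : E ≤ 8 := by
    have := hK R hRcard
    rw [hEdef] at this
    exact this
  -- (4) an edge inside `R` forces `P + 2M ≤ 3K + 1`
  have hnoedge : 1 ≤ E → P + 2 * M ≤ 3 * K + 1 := by
    intro hE
    have := five_three_noedge D hK N R hRcard K M hKdef hPle (by rw [hEdef]; exact hE)
    rw [hPdef] at this
    exact this
  -- (5) `E = 0`, `M ≤ 1`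
  obtain ⟨hE0, hM1⟩ : E = 0 ∧ M ≤ 1 := by
    rcases Nat.lt_or_ge K 9 with hK8 | hK9
    · have hK8' : K = 8 := by omega
      by_cases hE1 : 1 ≤ E
      · exfalso
        subst hK8'
        obtain ⟨hE8', hM0, hP25⟩ := five_three_cap_count_eight M P E m hdegsum hm hE8 hE1 (hnoedge hE1)
        subst hM0
        exact five_three_noedge_eight D hK N R hRcard hKdef (fun u hu => by have := hPle u hu; omega)
          (by rw [hPdef]; exact hP25) (by rw [hEdef]; exact hE8')
      · omega
    · exact five_three_cap_count K M P E m hdegsum hm h2 hE8 hK9 hnoedge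
  -- no edge inside `R`
  have hnoR : ∀ u ∈ R, degIn D R u = 0 := by
    intro u hu
    have hle : degIn D R u ≤ ∑ z ∈ R, degIn D R z := single_le_sum (fun _ _ => Nat.zero_le _) hu
    rw [← adjPairs_eq_sum_degIn, hEdef, hE0] at hle
    exact Nat.le_zero.mp hle
  rcases Nat.eq_zero_or_pos M with hM0 | hMpos
  · -- `M = 0`: no edge inside `N`, none inside `R`: `D ⊆ K(Nᶜ, N)`
    left
    have hnoN : ∀ y ∈ N, ∀ y', D.Adj y y' → y' ∉ N := by
      intro y hy y' hyy' hy'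
      have h0 : degIn D N y = 0 := by
        have hle : degIn D N y ≤ ∑ z ∈ N, degIn D N z := single_le_sum (fun _ _ => Nat.zero_le _) hy
        rw [hTf, hM0, mul_zero] at hle
        exact Nat.le_zero.mp hle
      unfold degIn at h0
      rw [card_eq_zero, filter_eq_empty_iff] at h0
      exact h0 hy' hyy'
    have hnoR' : ∀ u ∈ R, ∀ u', D.Adj u u' → u' ∉ R := by
      intro u hu u' huu' hu'
      have h0 := hnoR u hu
      unfold degIn at h0
      rw [card_eq_zero, filter_eq_empty_iff] at h0
      exact h0 hu' huu'
    refine ⟨Nᶜ, ?_, ?_⟩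
    · rw [card_compl, hKdef]
      omega
    · intro p q hpq
      rw [mem_compl, mem_compl, not_not]
      constructor
      · intro hpN
        by_contra hqN
        by_cases hpx : p = x
        · subst hpx
          exact hqN ((hmemN q).mpr hpq)
        by_cases hqx : q = x
        · subst hqx
          exact hpN ((hmemN p).mpr (D.adj_symm hpq))
        have hpR : p ∈ R := (hmemR p).mpr ⟨hpx, fun h => hpN ((hmemN p).mpr h)⟩
        have hqR : q ∈ R := (hmemR q).mpr ⟨hqx, fun h => hqN ((hmemN q).mpr h)⟩
        exact hnoR' p hpR q hpq hqR
      · intro hqN hpN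
        exact hnoN p hpN q hpq hqN
  · -- `M = 1`: the one-triangle structure `T` with `P = 4K − 4`
    right
    have hM1' : M = 1 := by omega
    subst hM1'
    have hP : P + 4 = 4 * K := by omega
    -- `Σ_R d² ≤ (K − 1) P`
    have hSR : ∑ u ∈ R, deg D u * deg D u ≤ (K - 1) * P := by
      have h : ∀ u ∈ R, deg D u * deg D u ≤ (K - 1) * degIn D N u := by
        intro u hu
        have e : deg D u = degIn D N u := by rw [hdegR u hu, hnoR u hu, add_zero]
        have hle : degIn D N u ≤ K - 1 := by have := hPle u hu; omega
        rw [e]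
        exact Nat.mul_le_mul_right _ hle
      calc ∑ u ∈ R, deg D u * deg D u ≤ ∑ u ∈ R, (K - 1) * degIn D N u := sum_le_sum h
        _ = (K - 1) * P := by rw [← mul_sum, hPdef]
    -- `Σ_N d² ≤ K + 14 + 6P`
    have hfg : ∑ y ∈ N, degIn D N y * degIn D R y ≤ 4 := by
      have := two_mul_sum_degIn_mul_degIn_le D hK x R (fun u hu => ((hmemR u).mp hu).1)
      rw [← hN, hM, hRcard] at this
      omega
    have hSN : ∑ y ∈ N, deg D y * deg D y ≤ K + 14 + 6 * P := by
      have h : ∀ y ∈ N, deg D y * deg D y ≤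
          1 + 3 * degIn D N y + 6 * degIn D R y + 2 * (degIn D N y * degIn D R y) := by
        intro y hy
        rw [hdegN y hy]
        apply cap_sq_bound_five
        · have h1 := degIn_nbhd_le_one D hK (x := x) (u := y) ((hmemN y).mp hy)
          rw [← hN] at h1
          exact h1
        · have := degIn_le_card D R y
          rw [hRcard] at this
          exact this
      calc ∑ y ∈ N, deg D y * deg D y
          ≤ ∑ y ∈ N, (1 + 3 * degIn D N y + 6 * degIn D R y + 2 * (degIn D N y * degIn D R y)) := sum_le_sum h
        _ = N.card + 3 * ∑ y ∈ N, degIn D N y + 6 * ∑ y ∈ N, degIn D R y +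
            2 * ∑ y ∈ N, degIn D N y * degIn D R y := by
          rw [sum_add_distrib, sum_add_distrib, sum_add_distrib, sum_const, smul_eq_mul, mul_one, mul_sum,
            mul_sum, mul_sum]
        _ ≤ K + 14 + 6 * P := by
          rw [hKdef, hTf, sum_degIn_comm D N R, hPdef]
          omega
    rw [hsplit (fun v => deg D v * deg D v), hdx, hKdef, hmdef, hcardV]
    exact five_three_cap_sq_arith K P _ _ m (by omega) hm hP hSN hSR

end C047

end TriangleCap

end PercRepro
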